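import Summits.CriticalPhenomena.PercolationContinuityZ3.Theorems.PercNearOneGluingNoHeavyLowerTailSunflowerXChainOnePetalK

/-!
# The X-CHAIN certificate for (RES0′), one-petal inequality — part 3: the face `g = h`, the `y`-interpolation and `xchain_one_petal_of`

(prove-1 gen 56, memo run/shared/lean/prim/prim-ineq-prove-1/FINDING-CHAIN-prove1-g56.md §3(B); model, chain equations and hypotheses as in
`…SunflowerXChainOnePetalEdges`.)  The face `(·,k,h,h)` (variable `h`), the interpolation in `y` (variable `x`, shifted power for `u_y`), and the monotone elimination of the unpriced cell `g`: **`xchain_one_petal_of`**.  The all-n theorem is `…SunflowerXChainCertificate`. [this work]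
-/

namespace Summit.CriticalPhenomena.PercolationContinuityZ3.Theorems.SunflowerPartition.SafeCalc.LinkedCurrency

section XChain

variable {τ σ s α00 α01 α11 c0 g ly lk lh lX : ℝ}

/- Standing hypotheses of the X-chain certificate (parameters with the leaf-leaf lower bound on c₀, exponents ≥ 0, the three chain equations
with x-factors, the three kink-dwarf inequalities with x-factors). -/
variable (hH : 0 < τ ∧ τ < 1 ∧ 0 ≤ σ ∧ σ < 1 ∧ 0 < s ∧ s < 1 ∧ 0 < α00 ∧ α00 ≤ α01 ∧ α01 ≤ α11 ∧ α11 ≤ 1 ∧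
      τ * σ + (1 - τ) * (1 - s) * α00 ≤ c0 ∧ 0 ≤ ly ∧ 0 ≤ lk ∧ 0 ≤ lh ∧ 0 ≤ lX ∧
      g = (c0 + τ * (1 - σ) * ((1 - s) * α00 + s * α01) + s * (1 - τ) * ((1 - σ) * α01 + σ * α11)) ∧
      (c0 + τ * (1 - σ) * ((1 - s) * α00 + s * α01) + s * (1 - τ) * ((1 - σ) * α01 + σ * 1)) = g * (1 / α11) ^ lh ∧
      (c0 + τ * (1 - σ) * ((1 - s) * α00 + s * 1) + s * (1 - τ) * ((1 - σ) * 1 + σ * 1)) = g * (1 / α01) ^ lk * (1 / α11) ^ lh * (((1 - s) * α00 + s * 1) / ((1 - s) * α00 + s * α01)) ^ lX ∧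
      (c0 + τ * (1 - σ) * ((1 - s) * 1 + s * 1) + s * (1 - τ) * ((1 - σ) * 1 + σ * 1)) = g * (1 / α00) ^ ly * (1 / α01) ^ lk * (1 / α11) ^ lh * (1 / ((1 - s) * α00 + s * α01)) ^ lX ∧
      (c0 + τ * (1 - σ) * ((1 - s) * α01 + s * α01) + s * (1 - τ) * ((1 - σ) * α01 + σ * α11)) ≤ g * (α01 / α00) ^ ly * (α01 / ((1 - s) * α00 + s * α01)) ^ lX ∧
      (c0 + τ * (1 - σ) * ((1 - s) * α00 + s * α11) + s * (1 - τ) * ((1 - σ) * α11 + σ * α11)) ≤ g * (α11 / α01) ^ lk * (((1 - s) * α00 + s * α11) / ((1 - s) * α00 + s * α01)) ^ lX ∧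
      (c0 + τ * (1 - σ) * ((1 - s) * α11 + s * α11) + s * (1 - τ) * ((1 - σ) * α11 + σ * α11)) ≤ g * (α11 / α00) ^ ly * (α11 / α01) ^ lk * (α11 / ((1 - s) * α00 + s * α01)) ^ lX)

include hH

/-- Face `(α₀₀,k,h,h)`, `α₁₁ ≤ h ≤ k`. -/
theorem xchain_gh0 : ∀ k : ℝ, α11 ≤ k → k ≤ 1 → ∀ h : ℝ, α11 ≤ h → h ≤ k → (c0 + τ * (1 - σ) * ((1 - s) * α00 + s * k) + s * (1 - τ) * ((1 - σ) * h + σ * h)) ≤ g * (α00 / α00) ^ ly * (k / α01) ^ lk * (h / α11) ^ lh * (((1 - s) * α00 + s * k) / ((1 - s) * α00 + s * α01)) ^ lX := by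
  have hb := xchain_basic hH
  obtain ⟨hτ0, hτ1, hσ0, hσ1, hs0, hs1, hα00, h01, h11, hα1, hc0, hly, hlk, hlh, hlX, hg, Eh, EH, -, -, Db, -⟩ := id hH
  obtain ⟨hg0, hbY0, u0, u1, u2, u3⟩ := hb
  have hα01 : 0 < α01 := lt_of_lt_of_le hα00 h01
  have hα11 : 0 < α11 := lt_of_lt_of_le hα01 h11
  have h1σ : 0 ≤ 1 - σ := sub_nonneg.2 hσ1.le
  have h1s : 0 ≤ 1 - s := sub_nonneg.2 hs1.le
  have h1τ : 0 ≤ 1 - τ := sub_nonneg.2 hτ1.le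
  have hπ : 0 ≤ (1 - τ) * (1 - s) * α00 := mul_nonneg (mul_nonneg h1τ h1s) hα00.le
  have hτσ : τ * σ ≤ c0 := le_trans (le_add_of_nonneg_right hπ) hc0
  have hc0' : 0 ≤ c0 := le_trans (mul_nonneg hτ0.le hσ0) hτσ
  have hbYne : ((1 - s) * α00 + s * α01) ≠ 0 := ne_of_gt hbY0
  have hsne : s ≠ 0 := ne_of_gt hs0
  have h1sne : (1 - s) ≠ 0 := ne_of_gt (sub_pos.2 hs1)
  have hα00ne : α00 ≠ 0 := ne_of_gt hα00
  have hα01ne : α01 ≠ 0 := ne_of_gt hα01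
  have hα11ne : α11 ≠ 0 := ne_of_gt hα11
  intro k hk0 hk1 h hh0 hh1
  have hk_nn : 0 ≤ k := le_trans hα11.le hk0
  have hA : 0 ≤ (c0 + τ * (1 - σ) * ((1 - s) * α00 + s * k) + s * (1 - τ) * (0)) :=
    add_nonneg (add_nonneg hc0' (mul_nonneg (mul_nonneg hτ0.le h1σ) (add_nonneg (mul_nonneg h1s hα00.le) (mul_nonneg hs0.le hk_nn)))) (mul_nonneg (mul_nonneg hs0.le h1τ) (le_refl 0))
  have hB : 0 ≤ (τ * (1 - σ) * (0) + s * (1 - τ) * ((1 - σ) + σ)) :=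
    add_nonneg (mul_nonneg (mul_nonneg hτ0.le h1σ) (le_refl 0)) (mul_nonneg (mul_nonneg hs0.le h1τ) ((by rw [show (1 - σ) + σ = (1:ℝ) by ring]; exact zero_le_one)))
  have e0 : (c0 + τ * (1 - σ) * ((1 - s) * α00 + s * k) + s * (1 - τ) * (0)) + (τ * (1 - σ) * (0) + s * (1 - τ) * ((1 - σ) + σ)) * α11 ≤ g * (α00 / α00) ^ ly * (k / α01) ^ lk * (((1 - s) * α00 + s * k) / ((1 - s) * α00 + s * α01)) ^ lX * (α11 / α11) ^ lh := by
    have h0 : (c0 + τ * (1 - σ) * ((1 - s) * α00 + s * k) + s * (1 - τ) * ((1 - σ) * α11 + σ * α11)) ≤ g * (α00 / α00) ^ ly * (k / α01) ^ lk * (α11 / α11) ^ lh * (((1 - s) * α00 + s * k) / ((1 - s) * α00 + s * α01)) ^ lX :=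
      xchain_kedge0 hH k hk0 hk1
    calc (c0 + τ * (1 - σ) * ((1 - s) * α00 + s * k) + s * (1 - τ) * (0)) + (τ * (1 - σ) * (0) + s * (1 - τ) * ((1 - σ) + σ)) * α11 = (c0 + τ * (1 - σ) * ((1 - s) * α00 + s * k) + s * (1 - τ) * ((1 - σ) * α11 + σ * α11)) := by ring
      _ ≤ g * (α00 / α00) ^ ly * (k / α01) ^ lk * (α11 / α11) ^ lh * (((1 - s) * α00 + s * k) / ((1 - s) * α00 + s * α01)) ^ lX := h0
      _ = g * (α00 / α00) ^ ly * (k / α01) ^ lk * (((1 - s) * α00 + s * k) / ((1 - s) * α00 + s * α01)) ^ lX * (α11 / α11) ^ lh := by ring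
  have e1 : (c0 + τ * (1 - σ) * ((1 - s) * α00 + s * k) + s * (1 - τ) * (0)) + (τ * (1 - σ) * (0) + s * (1 - τ) * ((1 - σ) + σ)) * k ≤ g * (α00 / α00) ^ ly * (k / α01) ^ lk * (((1 - s) * α00 + s * k) / ((1 - s) * α00 + s * α01)) ^ lX * (k / α11) ^ lh := by
    have h1 : (c0 + τ * (1 - σ) * ((1 - s) * α00 + s * k) + s * (1 - τ) * ((1 - σ) * k + σ * k)) ≤ g * (α00 / α00) ^ ly * (k / α01) ^ lk * (k / α11) ^ lh * (((1 - s) * α00 + s * k) / ((1 - s) * α00 + s * α01)) ^ lX :=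
      xchain_diag0 hH k hk0 hk1
    calc (c0 + τ * (1 - σ) * ((1 - s) * α00 + s * k) + s * (1 - τ) * (0)) + (τ * (1 - σ) * (0) + s * (1 - τ) * ((1 - σ) + σ)) * k = (c0 + τ * (1 - σ) * ((1 - s) * α00 + s * k) + s * (1 - τ) * ((1 - σ) * k + σ * k)) := by ring
      _ ≤ g * (α00 / α00) ^ ly * (k / α01) ^ lk * (k / α11) ^ lh * (((1 - s) * α00 + s * k) / ((1 - s) * α00 + s * α01)) ^ lX := h1
      _ = g * (α00 / α00) ^ ly * (k / α01) ^ lk * (((1 - s) * α00 + s * k) / ((1 - s) * α00 + s * α01)) ^ lX * (k / α11) ^ lh := by ring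
  have key : (c0 + τ * (1 - σ) * ((1 - s) * α00 + s * k) + s * (1 - τ) * (0)) + (τ * (1 - σ) * (0) + s * (1 - τ) * ((1 - σ) + σ)) * h ≤ g * (α00 / α00) ^ ly * (k / α01) ^ lk * (((1 - s) * α00 + s * k) / ((1 - s) * α00 + s * α01)) ^ lX * (h / α11) ^ lh :=
    affine_le_mul_rpow_of_endpoints₁ hA hB hα11 hα11 hh0 hh1 e0 e1
  calc (c0 + τ * (1 - σ) * ((1 - s) * α00 + s * k) + s * (1 - τ) * ((1 - σ) * h + σ * h)) = (c0 + τ * (1 - σ) * ((1 - s) * α00 + s * k) + s * (1 - τ) * (0)) + (τ * (1 - σ) * (0) + s * (1 - τ) * ((1 - σ) + σ)) * h := by ring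
    _ ≤ g * (α00 / α00) ^ ly * (k / α01) ^ lk * (((1 - s) * α00 + s * k) / ((1 - s) * α00 + s * α01)) ^ lX * (h / α11) ^ lh := key
    _ = g * (α00 / α00) ^ ly * (k / α01) ^ lk * (h / α11) ^ lh * (((1 - s) * α00 + s * k) / ((1 - s) * α00 + s * α01)) ^ lX := by ring

/-- Face `(k,k,h,h)`, `α₁₁ ≤ h ≤ k`. -/
theorem xchain_gh1 : ∀ k : ℝ, α11 ≤ k → k ≤ 1 → ∀ h : ℝ, α11 ≤ h → h ≤ k → (c0 + τ * (1 - σ) * ((1 - s) * k + s * k) + s * (1 - τ) * ((1 - σ) * h + σ * h)) ≤ g * (k / α00) ^ ly * (k / α01) ^ lk * (h / α11) ^ lh * (k / ((1 - s) * α00 + s * α01)) ^ lX := by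
  have hb := xchain_basic hH
  obtain ⟨hτ0, hτ1, hσ0, hσ1, hs0, hs1, hα00, h01, h11, hα1, hc0, hly, hlk, hlh, hlX, hg, Eh, -, Ef, -, -, Dc⟩ := id hH
  obtain ⟨hg0, hbY0, u0, u1, u2, u3⟩ := hb
  have hα01 : 0 < α01 := lt_of_lt_of_le hα00 h01
  have hα11 : 0 < α11 := lt_of_lt_of_le hα01 h11
  have h1σ : 0 ≤ 1 - σ := sub_nonneg.2 hσ1.le
  have h1s : 0 ≤ 1 - s := sub_nonneg.2 hs1.le
  have h1τ : 0 ≤ 1 - τ := sub_nonneg.2 hτ1.le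
  have hπ : 0 ≤ (1 - τ) * (1 - s) * α00 := mul_nonneg (mul_nonneg h1τ h1s) hα00.le
  have hτσ : τ * σ ≤ c0 := le_trans (le_add_of_nonneg_right hπ) hc0
  have hc0' : 0 ≤ c0 := le_trans (mul_nonneg hτ0.le hσ0) hτσ
  have hbYne : ((1 - s) * α00 + s * α01) ≠ 0 := ne_of_gt hbY0
  have hsne : s ≠ 0 := ne_of_gt hs0
  have h1sne : (1 - s) ≠ 0 := ne_of_gt (sub_pos.2 hs1)
  have hα00ne : α00 ≠ 0 := ne_of_gt hα00
  have hα01ne : α01 ≠ 0 := ne_of_gt hα01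
  have hα11ne : α11 ≠ 0 := ne_of_gt hα11
  intro k hk0 hk1 h hh0 hh1
  have hk_nn : 0 ≤ k := le_trans hα11.le hk0
  have hA : 0 ≤ (c0 + τ * (1 - σ) * ((1 - s) * k + s * k) + s * (1 - τ) * (0)) :=
    add_nonneg (add_nonneg hc0' (mul_nonneg (mul_nonneg hτ0.le h1σ) (add_nonneg (mul_nonneg h1s hk_nn) (mul_nonneg hs0.le hk_nn)))) (mul_nonneg (mul_nonneg hs0.le h1τ) (le_refl 0))
  have hB : 0 ≤ (τ * (1 - σ) * (0) + s * (1 - τ) * ((1 - σ) + σ)) :=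
    add_nonneg (mul_nonneg (mul_nonneg hτ0.le h1σ) (le_refl 0)) (mul_nonneg (mul_nonneg hs0.le h1τ) ((by rw [show (1 - σ) + σ = (1:ℝ) by ring]; exact zero_le_one)))
  have e0 : (c0 + τ * (1 - σ) * ((1 - s) * k + s * k) + s * (1 - τ) * (0)) + (τ * (1 - σ) * (0) + s * (1 - τ) * ((1 - σ) + σ)) * α11 ≤ g * (k / α00) ^ ly * (k / α01) ^ lk * (k / ((1 - s) * α00 + s * α01)) ^ lX * (α11 / α11) ^ lh := by
    have h0 : (c0 + τ * (1 - σ) * ((1 - s) * k + s * k) + s * (1 - τ) * ((1 - σ) * α11 + σ * α11)) ≤ g * (k / α00) ^ ly * (k / α01) ^ lk * (α11 / α11) ^ lh * (k / ((1 - s) * α00 + s * α01)) ^ lX :=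
      xchain_kedge1 hH k hk0 hk1
    calc (c0 + τ * (1 - σ) * ((1 - s) * k + s * k) + s * (1 - τ) * (0)) + (τ * (1 - σ) * (0) + s * (1 - τ) * ((1 - σ) + σ)) * α11 = (c0 + τ * (1 - σ) * ((1 - s) * k + s * k) + s * (1 - τ) * ((1 - σ) * α11 + σ * α11)) := by ring
      _ ≤ g * (k / α00) ^ ly * (k / α01) ^ lk * (α11 / α11) ^ lh * (k / ((1 - s) * α00 + s * α01)) ^ lX := h0
      _ = g * (k / α00) ^ ly * (k / α01) ^ lk * (k / ((1 - s) * α00 + s * α01)) ^ lX * (α11 / α11) ^ lh := by ring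
  have e1 : (c0 + τ * (1 - σ) * ((1 - s) * k + s * k) + s * (1 - τ) * (0)) + (τ * (1 - σ) * (0) + s * (1 - τ) * ((1 - σ) + σ)) * k ≤ g * (k / α00) ^ ly * (k / α01) ^ lk * (k / ((1 - s) * α00 + s * α01)) ^ lX * (k / α11) ^ lh := by
    have h1 : (c0 + τ * (1 - σ) * ((1 - s) * k + s * k) + s * (1 - τ) * ((1 - σ) * k + σ * k)) ≤ g * (k / α00) ^ ly * (k / α01) ^ lk * (k / α11) ^ lh * (k / ((1 - s) * α00 + s * α01)) ^ lX :=
      xchain_diag1 hH k hk0 hk1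
    calc (c0 + τ * (1 - σ) * ((1 - s) * k + s * k) + s * (1 - τ) * (0)) + (τ * (1 - σ) * (0) + s * (1 - τ) * ((1 - σ) + σ)) * k = (c0 + τ * (1 - σ) * ((1 - s) * k + s * k) + s * (1 - τ) * ((1 - σ) * k + σ * k)) := by ring
      _ ≤ g * (k / α00) ^ ly * (k / α01) ^ lk * (k / α11) ^ lh * (k / ((1 - s) * α00 + s * α01)) ^ lX := h1
      _ = g * (k / α00) ^ ly * (k / α01) ^ lk * (k / ((1 - s) * α00 + s * α01)) ^ lX * (k / α11) ^ lh := by ring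
  have key : (c0 + τ * (1 - σ) * ((1 - s) * k + s * k) + s * (1 - τ) * (0)) + (τ * (1 - σ) * (0) + s * (1 - τ) * ((1 - σ) + σ)) * h ≤ g * (k / α00) ^ ly * (k / α01) ^ lk * (k / ((1 - s) * α00 + s * α01)) ^ lX * (h / α11) ^ lh :=
    affine_le_mul_rpow_of_endpoints₁ hA hB hα11 hα11 hh0 hh1 e0 e1
  calc (c0 + τ * (1 - σ) * ((1 - s) * k + s * k) + s * (1 - τ) * ((1 - σ) * h + σ * h)) = (c0 + τ * (1 - σ) * ((1 - s) * k + s * k) + s * (1 - τ) * (0)) + (τ * (1 - σ) * (0) + s * (1 - τ) * ((1 - σ) + σ)) * h := by ring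
    _ ≤ g * (k / α00) ^ ly * (k / α01) ^ lk * (k / ((1 - s) * α00 + s * α01)) ^ lX * (h / α11) ^ lh := key
    _ = g * (k / α00) ^ ly * (k / α01) ^ lk * (h / α11) ^ lh * (k / ((1 - s) * α00 + s * α01)) ^ lX := by ring

/-- Region `(y,k,k,h)` (case `g = k ≤ h`): interpolation in `y`, variable `x`. -/
theorem xchain_y_gk : ∀ h : ℝ, α11 ≤ h → h ≤ 1 → ∀ k : ℝ, α01 ≤ k → k ≤ h → ∀ y : ℝ, α00 ≤ y → y ≤ k → (c0 + τ * (1 - σ) * ((1 - s) * y + s * k) + s * (1 - τ) * ((1 - σ) * k + σ * h)) ≤ g * (y / α00) ^ ly * (k / α01) ^ lk * (h / α11) ^ lh * (((1 - s) * y + s * k) / ((1 - s) * α00 + s * α01)) ^ lX := by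
  have hb := xchain_basic hH
  obtain ⟨hτ0, hτ1, hσ0, hσ1, hs0, hs1, hα00, h01, h11, hα1, hc0, hly, hlk, hlh, hlX, hg, Eh, EH, Ef, Da, Db, Dc⟩ := id hH
  obtain ⟨hg0, hbY0, u0, u1, u2, u3⟩ := hb
  have hα01 : 0 < α01 := lt_of_lt_of_le hα00 h01
  have hα11 : 0 < α11 := lt_of_lt_of_le hα01 h11
  have h1σ : 0 ≤ 1 - σ := sub_nonneg.2 hσ1.le
  have h1s : 0 ≤ 1 - s := sub_nonneg.2 hs1.le
  have h1τ : 0 ≤ 1 - τ := sub_nonneg.2 hτ1.le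
  have hπ : 0 ≤ (1 - τ) * (1 - s) * α00 := mul_nonneg (mul_nonneg h1τ h1s) hα00.le
  have hτσ : τ * σ ≤ c0 := le_trans (le_add_of_nonneg_right hπ) hc0
  have hc0' : 0 ≤ c0 := le_trans (mul_nonneg hτ0.le hσ0) hτσ
  have hbYne : ((1 - s) * α00 + s * α01) ≠ 0 := ne_of_gt hbY0
  have hsne : s ≠ 0 := ne_of_gt hs0
  have h1sne : (1 - s) ≠ 0 := ne_of_gt (sub_pos.2 hs1)
  have hα00ne : α00 ≠ 0 := ne_of_gt hα00
  have hα01ne : α01 ≠ 0 := ne_of_gt hα01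
  have hα11ne : α11 ≠ 0 := ne_of_gt hα11
  intro h hh0 hh1 k hk0 hk1 y hy0 hy1
  have hh_nn : 0 ≤ h := le_trans hα11.le hh0
  have hk_nn : 0 ≤ k := le_trans hα01.le hk0
  have hA : 0 ≤ (c0 + s * (1 - τ) * ((1 - σ) * k + σ * h)) := add_nonneg hc0' (mul_nonneg (mul_nonneg hs0.le h1τ) (add_nonneg (mul_nonneg h1σ hk_nn) (mul_nonneg hσ0 hh_nn)))
  have hB : 0 ≤ (τ * (1 - σ) * ((1 - s) * α00 + s * α01)) := mul_nonneg (mul_nonneg hτ0.le h1σ) hbY0.le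
  have hC : 0 ≤ (g * (k / α01) ^ lk * (h / α11) ^ lh) := mul_nonneg (mul_nonneg hg0.le (Real.rpow_nonneg (div_nonneg hk_nn hα01.le) _)) (Real.rpow_nonneg (div_nonneg hh_nn hα11.le) _)
  have hx0pos : 0 < (((1 - s) * α00 + s * k) / ((1 - s) * α00 + s * α01)) := div_pos (add_pos_of_nonneg_of_pos (mul_nonneg h1s hα00.le) (mul_pos hs0 (lt_of_lt_of_le hα01 hk0))) hbY0
  have hxv0 : (((1 - s) * α00 + s * k) / ((1 - s) * α00 + s * α01)) ≤ (((1 - s) * y + s * k) / ((1 - s) * α00 + s * α01)) := div_le_div_of_nonneg_right (add_le_add_left (mul_le_mul_of_nonneg_left hy0 h1s) _) hbY0.le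
  have hxv1 : (((1 - s) * y + s * k) / ((1 - s) * α00 + s * α01)) ≤ (k / ((1 - s) * α00 + s * α01)) := div_le_div_of_nonneg_right (by have hh := mul_le_mul_of_nonneg_left hy1 h1s; linarith only [hh]) hbY0.le
  have ha_y1 : 0 < (((1 - s) * α00 + s * α01) / ((1 - s) * α00)) := div_pos hbY0 (mul_pos (sub_pos.2 hs1) hα00)
  have hc_y1 : 0 ≤ (s * k / ((1 - s) * α00)) := div_nonneg (mul_nonneg hs0.le hk_nn) (mul_pos (sub_pos.2 hs1) hα00).le
  have id_y1_lo : (α00 / α00) = (((1 - s) * α00 + s * α01) / ((1 - s) * α00)) * (((1 - s) * α00 + s * k) / ((1 - s) * α00 + s * α01)) - (s * k / ((1 - s) * α00)) := by field_simp; ring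
  have id_y1_hi : (k / α00) = (((1 - s) * α00 + s * α01) / ((1 - s) * α00)) * (k / ((1 - s) * α00 + s * α01)) - (s * k / ((1 - s) * α00)) := by field_simp
  have id_y1_v : (y / α00) = (((1 - s) * α00 + s * α01) / ((1 - s) * α00)) * (((1 - s) * y + s * k) / ((1 - s) * α00 + s * α01)) - (s * k / ((1 - s) * α00)) := by field_simp; ring
  have hs_y1 : (s * k / ((1 - s) * α00)) < (((1 - s) * α00 + s * α01) / ((1 - s) * α00)) * (((1 - s) * α00 + s * k) / ((1 - s) * α00 + s * α01)) := by
    have hh : 0 < (α00 / α00) := div_pos hα00 hα00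
    rw [id_y1_lo] at hh; exact sub_pos.1 hh
  have e0 : (c0 + s * (1 - τ) * ((1 - σ) * k + σ * h)) + (τ * (1 - σ) * ((1 - s) * α00 + s * α01)) * (((1 - s) * α00 + s * k) / ((1 - s) * α00 + s * α01)) ≤ (g * (k / α01) ^ lk * (h / α11) ^ lh) * (((1 - s) * α00 + s * k) / ((1 - s) * α00 + s * α01)) ^ lX * ((((1 - s) * α00 + s * α01) / ((1 - s) * α00)) * (((1 - s) * α00 + s * k) / ((1 - s) * α00 + s * α01)) - (s * k / ((1 - s) * α00))) ^ ly := by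
    have h0 : (c0 + τ * (1 - σ) * ((1 - s) * α00 + s * k) + s * (1 - τ) * ((1 - σ) * k + σ * h)) ≤ g * (α00 / α00) ^ ly * (k / α01) ^ lk * (h / α11) ^ lh * (((1 - s) * α00 + s * k) / ((1 - s) * α00 + s * α01)) ^ lX :=
      xchain_gk0 hH h hh0 hh1 k hk0 hk1
    rw [id_y1_lo] at h0
    calc (c0 + s * (1 - τ) * ((1 - σ) * k + σ * h)) + (τ * (1 - σ) * ((1 - s) * α00 + s * α01)) * (((1 - s) * α00 + s * k) / ((1 - s) * α00 + s * α01)) = (c0 + τ * (1 - σ) * ((1 - s) * α00 + s * k) + s * (1 - τ) * ((1 - σ) * k + σ * h)) := by field_simp; ring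
      _ ≤ _ := h0
      _ = (g * (k / α01) ^ lk * (h / α11) ^ lh) * (((1 - s) * α00 + s * k) / ((1 - s) * α00 + s * α01)) ^ lX * ((((1 - s) * α00 + s * α01) / ((1 - s) * α00)) * (((1 - s) * α00 + s * k) / ((1 - s) * α00 + s * α01)) - (s * k / ((1 - s) * α00))) ^ ly := by ring
  have e1 : (c0 + s * (1 - τ) * ((1 - σ) * k + σ * h)) + (τ * (1 - σ) * ((1 - s) * α00 + s * α01)) * (k / ((1 - s) * α00 + s * α01)) ≤ (g * (k / α01) ^ lk * (h / α11) ^ lh) * (k / ((1 - s) * α00 + s * α01)) ^ lX * ((((1 - s) * α00 + s * α01) / ((1 - s) * α00)) * (k / ((1 - s) * α00 + s * α01)) - (s * k / ((1 - s) * α00))) ^ ly := by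
    have h1 : (c0 + τ * (1 - σ) * ((1 - s) * k + s * k) + s * (1 - τ) * ((1 - σ) * k + σ * h)) ≤ g * (k / α00) ^ ly * (k / α01) ^ lk * (h / α11) ^ lh * (k / ((1 - s) * α00 + s * α01)) ^ lX :=
      xchain_gk1 hH h hh0 hh1 k hk0 hk1
    rw [id_y1_hi] at h1
    calc (c0 + s * (1 - τ) * ((1 - σ) * k + σ * h)) + (τ * (1 - σ) * ((1 - s) * α00 + s * α01)) * (k / ((1 - s) * α00 + s * α01)) = (c0 + τ * (1 - σ) * ((1 - s) * k + s * k) + s * (1 - τ) * ((1 - σ) * k + σ * h)) := by field_simp; ring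
      _ ≤ _ := h1
      _ = (g * (k / α01) ^ lk * (h / α11) ^ lh) * (k / ((1 - s) * α00 + s * α01)) ^ lX * ((((1 - s) * α00 + s * α01) / ((1 - s) * α00)) * (k / ((1 - s) * α00 + s * α01)) - (s * k / ((1 - s) * α00))) ^ ly := by ring
  have key : (c0 + s * (1 - τ) * ((1 - σ) * k + σ * h)) + (τ * (1 - σ) * ((1 - s) * α00 + s * α01)) * (((1 - s) * y + s * k) / ((1 - s) * α00 + s * α01)) ≤ (g * (k / α01) ^ lk * (h / α11) ^ lh) * (((1 - s) * y + s * k) / ((1 - s) * α00 + s * α01)) ^ lX * ((((1 - s) * α00 + s * α01) / ((1 - s) * α00)) * (((1 - s) * y + s * k) / ((1 - s) * α00 + s * α01)) - (s * k / ((1 - s) * α00))) ^ ly :=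
    affine_le_shifted_rpow_of_endpoints₁ hA hB hC hly ha_y1 hc_y1 hx0pos hxv0 hxv1 hs_y1 e0 e1
  rw [id_y1_v]
  calc (c0 + τ * (1 - σ) * ((1 - s) * y + s * k) + s * (1 - τ) * ((1 - σ) * k + σ * h)) = (c0 + s * (1 - τ) * ((1 - σ) * k + σ * h)) + (τ * (1 - σ) * ((1 - s) * α00 + s * α01)) * (((1 - s) * y + s * k) / ((1 - s) * α00 + s * α01)) := by field_simp; ring
    _ ≤ (g * (k / α01) ^ lk * (h / α11) ^ lh) * (((1 - s) * y + s * k) / ((1 - s) * α00 + s * α01)) ^ lX * ((((1 - s) * α00 + s * α01) / ((1 - s) * α00)) * (((1 - s) * y + s * k) / ((1 - s) * α00 + s * α01)) - (s * k / ((1 - s) * α00))) ^ ly := key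
    _ = _ := by ring

/-- Region `(y,k,h,h)` (case `g = h ≤ k`): interpolation in `y`, variable `x`. -/
theorem xchain_y_gh : ∀ k : ℝ, α11 ≤ k → k ≤ 1 → ∀ h : ℝ, α11 ≤ h → h ≤ k → ∀ y : ℝ, α00 ≤ y → y ≤ k → (c0 + τ * (1 - σ) * ((1 - s) * y + s * k) + s * (1 - τ) * ((1 - σ) * h + σ * h)) ≤ g * (y / α00) ^ ly * (k / α01) ^ lk * (h / α11) ^ lh * (((1 - s) * y + s * k) / ((1 - s) * α00 + s * α01)) ^ lX := by
  have hb := xchain_basic hH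
  obtain ⟨hτ0, hτ1, hσ0, hσ1, hs0, hs1, hα00, h01, h11, hα1, hc0, hly, hlk, hlh, hlX, hg, Eh, EH, Ef, -, Db, Dc⟩ := id hH
  obtain ⟨hg0, hbY0, u0, u1, u2, u3⟩ := hb
  have hα01 : 0 < α01 := lt_of_lt_of_le hα00 h01
  have hα11 : 0 < α11 := lt_of_lt_of_le hα01 h11
  have h1σ : 0 ≤ 1 - σ := sub_nonneg.2 hσ1.le
  have h1s : 0 ≤ 1 - s := sub_nonneg.2 hs1.le
  have h1τ : 0 ≤ 1 - τ := sub_nonneg.2 hτ1.le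
  have hπ : 0 ≤ (1 - τ) * (1 - s) * α00 := mul_nonneg (mul_nonneg h1τ h1s) hα00.le
  have hτσ : τ * σ ≤ c0 := le_trans (le_add_of_nonneg_right hπ) hc0
  have hc0' : 0 ≤ c0 := le_trans (mul_nonneg hτ0.le hσ0) hτσ
  have hbYne : ((1 - s) * α00 + s * α01) ≠ 0 := ne_of_gt hbY0
  have hsne : s ≠ 0 := ne_of_gt hs0
  have h1sne : (1 - s) ≠ 0 := ne_of_gt (sub_pos.2 hs1)
  have hα00ne : α00 ≠ 0 := ne_of_gt hα00
  have hα01ne : α01 ≠ 0 := ne_of_gt hα01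
  have hα11ne : α11 ≠ 0 := ne_of_gt hα11
  intro k hk0 hk1 h hh0 hh1 y hy0 hy1
  have hh_nn : 0 ≤ h := le_trans hα11.le hh0
  have hk_nn : 0 ≤ k := le_trans hα11.le hk0
  have hA : 0 ≤ (c0 + s * (1 - τ) * ((1 - σ) * h + σ * h)) := add_nonneg hc0' (mul_nonneg (mul_nonneg hs0.le h1τ) (add_nonneg (mul_nonneg h1σ hh_nn) (mul_nonneg hσ0 hh_nn)))
  have hB : 0 ≤ (τ * (1 - σ) * ((1 - s) * α00 + s * α01)) := mul_nonneg (mul_nonneg hτ0.le h1σ) hbY0.le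
  have hC : 0 ≤ (g * (k / α01) ^ lk * (h / α11) ^ lh) := mul_nonneg (mul_nonneg hg0.le (Real.rpow_nonneg (div_nonneg hk_nn hα01.le) _)) (Real.rpow_nonneg (div_nonneg hh_nn hα11.le) _)
  have hx0pos : 0 < (((1 - s) * α00 + s * k) / ((1 - s) * α00 + s * α01)) := div_pos (add_pos_of_nonneg_of_pos (mul_nonneg h1s hα00.le) (mul_pos hs0 (lt_of_lt_of_le hα11 hk0))) hbY0
  have hxv0 : (((1 - s) * α00 + s * k) / ((1 - s) * α00 + s * α01)) ≤ (((1 - s) * y + s * k) / ((1 - s) * α00 + s * α01)) := div_le_div_of_nonneg_right (add_le_add_left (mul_le_mul_of_nonneg_left hy0 h1s) _) hbY0.le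
  have hxv1 : (((1 - s) * y + s * k) / ((1 - s) * α00 + s * α01)) ≤ (k / ((1 - s) * α00 + s * α01)) := div_le_div_of_nonneg_right (by have hh := mul_le_mul_of_nonneg_left hy1 h1s; linarith only [hh]) hbY0.le
  have ha_y1 : 0 < (((1 - s) * α00 + s * α01) / ((1 - s) * α00)) := div_pos hbY0 (mul_pos (sub_pos.2 hs1) hα00)
  have hc_y1 : 0 ≤ (s * k / ((1 - s) * α00)) := div_nonneg (mul_nonneg hs0.le hk_nn) (mul_pos (sub_pos.2 hs1) hα00).le
  have id_y1_lo : (α00 / α00) = (((1 - s) * α00 + s * α01) / ((1 - s) * α00)) * (((1 - s) * α00 + s * k) / ((1 - s) * α00 + s * α01)) - (s * k / ((1 - s) * α00)) := by field_simp; ring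
  have id_y1_hi : (k / α00) = (((1 - s) * α00 + s * α01) / ((1 - s) * α00)) * (k / ((1 - s) * α00 + s * α01)) - (s * k / ((1 - s) * α00)) := by field_simp
  have id_y1_v : (y / α00) = (((1 - s) * α00 + s * α01) / ((1 - s) * α00)) * (((1 - s) * y + s * k) / ((1 - s) * α00 + s * α01)) - (s * k / ((1 - s) * α00)) := by field_simp; ring
  have hs_y1 : (s * k / ((1 - s) * α00)) < (((1 - s) * α00 + s * α01) / ((1 - s) * α00)) * (((1 - s) * α00 + s * k) / ((1 - s) * α00 + s * α01)) := by
    have hh : 0 < (α00 / α00) := div_pos hα00 hα00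
    rw [id_y1_lo] at hh; exact sub_pos.1 hh
  have e0 : (c0 + s * (1 - τ) * ((1 - σ) * h + σ * h)) + (τ * (1 - σ) * ((1 - s) * α00 + s * α01)) * (((1 - s) * α00 + s * k) / ((1 - s) * α00 + s * α01)) ≤ (g * (k / α01) ^ lk * (h / α11) ^ lh) * (((1 - s) * α00 + s * k) / ((1 - s) * α00 + s * α01)) ^ lX * ((((1 - s) * α00 + s * α01) / ((1 - s) * α00)) * (((1 - s) * α00 + s * k) / ((1 - s) * α00 + s * α01)) - (s * k / ((1 - s) * α00))) ^ ly := by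
    have h0 : (c0 + τ * (1 - σ) * ((1 - s) * α00 + s * k) + s * (1 - τ) * ((1 - σ) * h + σ * h)) ≤ g * (α00 / α00) ^ ly * (k / α01) ^ lk * (h / α11) ^ lh * (((1 - s) * α00 + s * k) / ((1 - s) * α00 + s * α01)) ^ lX :=
      xchain_gh0 hH k hk0 hk1 h hh0 hh1
    rw [id_y1_lo] at h0
    calc (c0 + s * (1 - τ) * ((1 - σ) * h + σ * h)) + (τ * (1 - σ) * ((1 - s) * α00 + s * α01)) * (((1 - s) * α00 + s * k) / ((1 - s) * α00 + s * α01)) = (c0 + τ * (1 - σ) * ((1 - s) * α00 + s * k) + s * (1 - τ) * ((1 - σ) * h + σ * h)) := by field_simp; ring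
      _ ≤ _ := h0
      _ = (g * (k / α01) ^ lk * (h / α11) ^ lh) * (((1 - s) * α00 + s * k) / ((1 - s) * α00 + s * α01)) ^ lX * ((((1 - s) * α00 + s * α01) / ((1 - s) * α00)) * (((1 - s) * α00 + s * k) / ((1 - s) * α00 + s * α01)) - (s * k / ((1 - s) * α00))) ^ ly := by ring
  have e1 : (c0 + s * (1 - τ) * ((1 - σ) * h + σ * h)) + (τ * (1 - σ) * ((1 - s) * α00 + s * α01)) * (k / ((1 - s) * α00 + s * α01)) ≤ (g * (k / α01) ^ lk * (h / α11) ^ lh) * (k / ((1 - s) * α00 + s * α01)) ^ lX * ((((1 - s) * α00 + s * α01) / ((1 - s) * α00)) * (k / ((1 - s) * α00 + s * α01)) - (s * k / ((1 - s) * α00))) ^ ly := by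
    have h1 : (c0 + τ * (1 - σ) * ((1 - s) * k + s * k) + s * (1 - τ) * ((1 - σ) * h + σ * h)) ≤ g * (k / α00) ^ ly * (k / α01) ^ lk * (h / α11) ^ lh * (k / ((1 - s) * α00 + s * α01)) ^ lX :=
      xchain_gh1 hH k hk0 hk1 h hh0 hh1
    rw [id_y1_hi] at h1
    calc (c0 + s * (1 - τ) * ((1 - σ) * h + σ * h)) + (τ * (1 - σ) * ((1 - s) * α00 + s * α01)) * (k / ((1 - s) * α00 + s * α01)) = (c0 + τ * (1 - σ) * ((1 - s) * k + s * k) + s * (1 - τ) * ((1 - σ) * h + σ * h)) := by field_simp; ring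
      _ ≤ _ := h1
      _ = (g * (k / α01) ^ lk * (h / α11) ^ lh) * (k / ((1 - s) * α00 + s * α01)) ^ lX * ((((1 - s) * α00 + s * α01) / ((1 - s) * α00)) * (k / ((1 - s) * α00 + s * α01)) - (s * k / ((1 - s) * α00))) ^ ly := by ring
  have key : (c0 + s * (1 - τ) * ((1 - σ) * h + σ * h)) + (τ * (1 - σ) * ((1 - s) * α00 + s * α01)) * (((1 - s) * y + s * k) / ((1 - s) * α00 + s * α01)) ≤ (g * (k / α01) ^ lk * (h / α11) ^ lh) * (((1 - s) * y + s * k) / ((1 - s) * α00 + s * α01)) ^ lX * ((((1 - s) * α00 + s * α01) / ((1 - s) * α00)) * (((1 - s) * y + s * k) / ((1 - s) * α00 + s * α01)) - (s * k / ((1 - s) * α00))) ^ ly :=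
    affine_le_shifted_rpow_of_endpoints₁ hA hB hC hly ha_y1 hc_y1 hx0pos hxv0 hxv1 hs_y1 e0 e1
  rw [id_y1_v]
  calc (c0 + τ * (1 - σ) * ((1 - s) * y + s * k) + s * (1 - τ) * ((1 - σ) * h + σ * h)) = (c0 + s * (1 - τ) * ((1 - σ) * h + σ * h)) + (τ * (1 - σ) * ((1 - s) * α00 + s * α01)) * (((1 - s) * y + s * k) / ((1 - s) * α00 + s * α01)) := by field_simp; ring
    _ ≤ (g * (k / α01) ^ lk * (h / α11) ^ lh) * (((1 - s) * y + s * k) / ((1 - s) * α00 + s * α01)) ^ lX * ((((1 - s) * α00 + s * α01) / ((1 - s) * α00)) * (((1 - s) * y + s * k) / ((1 - s) * α00 + s * α01)) - (s * k / ((1 - s) * α00))) ^ ly := key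
    _ = _ := by ring

/-- **THE X-CHAIN CERTIFICATE, ONE-PETAL FORM.**  Under the standing hypotheses every petal satisfies
`G(y,k,g,h) ≤ g·(y/α₀₀)^λ_y·(k/α₀₁)^λ_k·(h/α₁₁)^λ_h·(Ȳ/b_Ȳ)^λ_X`. [this work] -/
theorem xchain_one_petal_of : ∀ y k gc h : ℝ, α00 ≤ y → y ≤ k → k ≤ 1 → α01 ≤ gc → gc ≤ k → gc ≤ h → α11 ≤ h → h ≤ 1 →
    (c0 + τ * (1 - σ) * ((1 - s) * y + s * k) + s * (1 - τ) * ((1 - σ) * gc + σ * h)) ≤ g * (y / α00) ^ ly * (k / α01) ^ lk * (h / α11) ^ lh * (((1 - s) * y + s * k) / ((1 - s) * α00 + s * α01)) ^ lX := by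
  obtain ⟨-, hτ1, -, hσ1, hs0, -, -, -, -, -, -, -, -, -, -, -, -, -, -, -, -, -⟩ := id hH
  have h1σ : 0 ≤ 1 - σ := sub_nonneg.2 hσ1.le
  have h1τ : 0 ≤ 1 - τ := sub_nonneg.2 hτ1.le
  intro y k gc h hy0 hyk hk1 hg0 hgk hgh hh0 hh1
  rcases le_total k h with hkh | hhk
  · have mono : (c0 + τ * (1 - σ) * ((1 - s) * y + s * k) + s * (1 - τ) * ((1 - σ) * gc + σ * h)) ≤ (c0 + τ * (1 - σ) * ((1 - s) * y + s * k) + s * (1 - τ) * ((1 - σ) * k + σ * h)) := by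
      have idm : (c0 + τ * (1 - σ) * ((1 - s) * y + s * k) + s * (1 - τ) * ((1 - σ) * k + σ * h)) - (c0 + τ * (1 - σ) * ((1 - s) * y + s * k) + s * (1 - τ) * ((1 - σ) * gc + σ * h)) = s * (1 - τ) * (1 - σ) * (k - gc) := by ring
      linarith only [mul_nonneg (mul_nonneg (mul_nonneg hs0.le h1τ) h1σ) (sub_nonneg.2 hgk), idm]
    exact le_trans mono (xchain_y_gk hH h hh0 hh1 k (le_trans hg0 hgk) hkh y hy0 hyk)
  · have mono : (c0 + τ * (1 - σ) * ((1 - s) * y + s * k) + s * (1 - τ) * ((1 - σ) * gc + σ * h)) ≤ (c0 + τ * (1 - σ) * ((1 - s) * y + s * k) + s * (1 - τ) * ((1 - σ) * h + σ * h)) := by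
      have idm : (c0 + τ * (1 - σ) * ((1 - s) * y + s * k) + s * (1 - τ) * ((1 - σ) * h + σ * h)) - (c0 + τ * (1 - σ) * ((1 - s) * y + s * k) + s * (1 - τ) * ((1 - σ) * gc + σ * h)) = s * (1 - τ) * (1 - σ) * (h - gc) := by ring
      linarith only [mul_nonneg (mul_nonneg (mul_nonneg hs0.le h1τ) h1σ) (sub_nonneg.2 hgh), idm]
    exact le_trans mono (xchain_y_gh hH k (le_trans hh0 hhk) hk1 h hh0 hhk y hy0 hyk)

end XChain

end Summit.CriticalPhenomena.PercolationContinuityZ3.Theorems.SunflowerPartition.SafeCalc.LinkedCurrency
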